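import Literature.MathematicalPhysics.QuantumFieldTheory.Balaban1983to89.B9Eq325GaugeModeLetterDiagonal
import Literature.MathematicalPhysics.QuantumFieldTheory.Balaban1983to89.B9Eq325RLipschitzSqrtTowerTwoBackgroundsLinear
import Literature.MathematicalPhysics.QuantumFieldTheory.Balaban1983to89.B9Eq386GreenLipschitzEnergy

/-!
# `Balaban1983to89.B9Eq325GaugeModeLetterTwoBackgrounds` — T. Bałaban, *Propagators for lattice gauge theories in a background field*, Commun. Math. Phys.
# **99** (1985) 389–434 [Balaban1985BackgroundPropagators] (3.21)–(3.25) p. 394, (3.119)–(3.120) p. 419, Thm 3.4 p. 400, Thm 3.11 p. 416, (3.35) p. 396: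
# **THE GAUGE-MODE LETTER OF THE `Δ_π` PORT IS LIPSCHITZ IN THE BACKGROUND ON PRINT's DIAGONAL** — for two small backgrounds `U`, `V` (`‖U(b) − V(b)‖ ≤ δη`,
# averaged `‖Ū^j − V̄^j‖ ≤ δ_j ≤ δr^j`) and `λ_X(w) := G′_k(X)R_k(X)D*_Xw`: `‖λ_U(w) − λ_V(w)‖ ≤ C·δ·N₁(w)` and `‖D_Uλ_U(w) − D_Vλ_V(w)‖ ≤ C·δ·N₁(w)` with
# ONE `∃ α₀ δ₀ C` BEFORE EVERY BINDER — the two-background («(b3)») twin of NE9 leaf-02's `B9Eq325GaugeModeLetterDiagonal` (the `λ`-letters at ONE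
# background), storey (T2) of the two-background θ-letter of the port (the OWNER t4-ne9-p1's GO, journal `CLAIMS.log` l.53352 W-9 (α))

statement-level skeleton of published theorems with citation tags; proofs where landed; nothing here is a claim about the Yang–Mills mass gap

PDF held: `paper:balaban1985-cmp99-background-propagators` (journal page = PDF page + 388), pp. 394, 396, 400, 407, 419 (p0006–p0008, p0012, p0031).

CITATION HEADER (lean-in-tree rule 2026-08-18).  Audit cell `pub-balaban`, sub-cell `t4`, NE9 crux team (2): LEAF PROVER 04 (`b2b-balaban-t4-ne9-formalise-leaf-04`
gen 78), INTENT-5 = storey (T2) of OFFER O-ne9leaf04-g78-1 (the Δ_π port, DIAGNOSIS D-ne9p1-g87-1): the two-background θ-letter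
`‖⟨u, (Δ′_π,k(U) − Δ′_π,k(V))v⟩‖ = O(δ)` needs `λ_U − λ_V` and `D_Uλ_U − D_Vλ_V` to be `O(δ)` — this file ((T1) = `B9Eq34CurlGaugeModeTwoBackgrounds`; (T3) =
the assembly, successor).  THE PRINT: p. 394 (3.21)–(3.25) (`R(U)`, `Δ′_{a′}(U) = Δ_U + Q′*a′Q′`, `G′ = (Δ′)⁻¹`); p. 400 Thm 3.4 (verbatim via the suppliers):
*«G(U) is an analytic function of U′ on the space of configurations U′ satisfying (3.35)»* — read in the cell as Lipschitz continuity between two points of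
the small-field ball; p. 407 (3.84)–(3.86) (the letters are Lipschitz in the background; paraphrase); p. 419 (3.119)–(3.120) (`π = 1 − DG′RD*`).

WHAT IS PROVED (sorry-free; proof lane — no `def`, no `Prop` placeholder; [folklore] resolvent bookkeeping over landed letters).
* **`exists_gaugeMode_letters_two_backgrounds`** — `∃ α₀ δ₀ C > 0` (closed in `(d, L, M_φ, M_φ′, a′, r)`) such that on the diagonal (`ηL^{n+1} = 1`,
  `c₀(L^{n+1})^d = c₁`), for `U`, `V` with mutually adjoint transporters, `U(b), V(b) ∈ U1`, `‖U(b) − 1‖, ‖V(b) − 1‖ ≤ αη`, `‖U(b) − V(b)‖ ≤ δη`, level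
  averages `U1`-valued with `‖Ū^j(b) − 1‖, ‖V̄^j(b) − 1‖ ≤ ε_j ≤ αr^j` and `‖Ū^j(b) − V̄^j(b)‖ ≤ δ_j ≤ δr^j` (`j < n+1`), `0 ≤ α ≤ α₀`, `0 ≤ δ ≤ δ₀`, ANY
  positivity witnesses `hpos′_U`, `hpos′_V` of `Δ′_{a′,k}(U)`, `Δ′_{a′,k}(V)` and every bond field `w`:
  `‖λ_U(w) − λ_V(w)‖ ≤ C·δ·N₁(w)` and `‖D_Uλ_U(w) − D_Vλ_V(w)‖ ≤ C·δ·N₁(w)`, `λ_X(w) := GpOfUk … X … (RofUk … X (D*_Xw))`, `N₁(w) = √(‖curl₁w‖² + ‖div₁w‖² + ‖w‖²)`.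
  MECHANISM (no gauge-mode identity needed — the resolvent route): `λ_U − λ_V = (G′_U − G′_V)y_U + G′_V(y_U − y_V)`, `y_X = R_XD*_Xw`;
  `B9Eq386GreenLipschitzEnergy.weight_green_sub_le` in the flat SITE weight `N(λ) = √(‖D_1λ‖² + ‖λ‖²)` with the strong site coercivity at `U` and at `V`
  (`B9Thm311SitePrimeFormCoerciveTowerCanonical.exists_strong_site_coercive_tower_diagonal`) and the site form defect
  `‖⟨u, Δ′_Vv⟩ − ⟨u, Δ′_Uv⟩‖ ≤ Θ̄δ·N(u)N(v)` (`⟨u, Δ′_Xv⟩ = ⟨D_Xu, D_Xv⟩ + a′⟨Q̃′_Xu, Q̃′_Xv⟩`; `norm_inner_sub_inner_le` with the two-background site letters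
  `‖D_Uλ − D_Vλ‖ ≤ √d·2M_φM_φ′·δ‖λ‖` (`B9Eq325RLipschitzSqrtTowerTwoBackgroundsDiagonal.norm_covDerivL2K_sub_le_diagonal₂`) and
  `‖Q̃′_k(U)λ − Q̃′_k(V)λ‖ ≤ s_Qδ‖λ‖` (`B9Eq319QprimeTowerLipschitzL2TwoBackgroundsChain.norm_QtildeTower_sub_QtildeTower_le_linear`, the diagonal root `= 1`));
  `N(G′_Xy) ≤ γ′⁻¹‖y‖` (`weight_green_le`); `‖y_U‖ ≤ ‖D*_Uw‖ ≤ (1 + √d·2M_φM_φ′)N₁(w)` (`norm_projR_le`, `norm_covDivL2K_sub_le`);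
  `‖y_U − y_V‖ ≤ C_R^{(2)}δ‖D*_Uw‖ + √d·2M_φM_φ′δ‖w‖` (`B9Eq325RLipschitzSqrtTowerTwoBackgroundsLinear.exists_norm_RofUk_sub_RofUk_le_two_backgrounds`,
  `norm_covDivL2K_sub_le₂`); `‖D_Uμ‖ ≤ ‖D_1μ‖ + √d·2M_φM_φ′α‖μ‖`.
MODEL ∕ DECLARED READINGS.  (M1) those of `B9Eq325GaugeModeLetterDiagonal` (tower `towerP L m`, fibre `W` along `φ`, weights `c₀`, `c₁`, scalar `η⁻¹` on
the diagonal, real `a′ > 0`, geometric profile ratio `r < 1`).  (M2) `hRS` ×2, `U1` ×2, the bond windows, the bond CLOSENESS `δη`, the averaged windows and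
the averaged closeness `δ_j` (the Lipschitz continuity `U ↦ Ū` is NOT proved here), `hpos′_U`, `hpos′_V` are HYPOTHESES; `C` depends on `a′` through `γ′`.
HONEST SCOPE.  [folklore] resolvent arithmetic + composition BY NAME; FIRST order between two small backgrounds on the diagonal ONLY; crude constants; no
estimate at print's strength; NOT the θ-letter (the two-background assembly is storey (T3), a separate file).  NOT summit progress (cell pub-balaban: NE9
NOT PRINTED ∕ NOT PROVED; «NE9 ⇐ the named binders»; row WALLED ON A MODEL (O-NE9-1; NEEDS-COORDINATOR #5 UNRULED); spine PROVED 0∕9; rung (B)+1 finite T⁴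
— NOT infinite volume, NOT mass gap, NOT BetaPertH, NOT Clay).  HONEST DEPENDENCY (cell line): continuum YM on T⁴ ⇐ BetaPertH ∧ nine spine estimates (0/9
proved); BetaPertH ⇐ (D1) ∧ (D4) ∧ CAP+tail; G-an2-4 gates asym, D1 and NE2/3/4.  NEW file; nothing modified.  Net new unproved facts: 0.
-/

noncomputable section

open scoped BigOperators InnerProductSpace ComplexConjugate

namespace Literature.MathematicalPhysics.QuantumFieldTheory.Balaban1983to89.B9Eq325GaugeModeLetterTwoBackgrounds

open B4Sect5Torus (TSite)
open B9SectCLatticeCarrier (Bond)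
open B7Prop1Explicit (U1)
open B9Eq311L2Pairing (WL2)
open B11Eq103H1Complex (SiteL2K BondL2K covDerivL2K covDivL2K covLaplaceSiteK greenK adjoint_covDerivL2K)
open B9Eq310HessianOperator (adTransportW covCurlL2K)
open B9Eq315QTower (towerP UlevOf)
open B9Eq326OperatorTower (QprimeTowerW RofUk)
open B5Eq172HodgePositivity (adTransportW_one adTransportW_inv_one)
open B9Eq324DeltaPrimeATower (laplacePrimeAk GpOfUk)
open B9Thm311SitePrimeFormCoerciveTowerCanonical (exists_strong_site_coercive_tower_diagonal)
open B9Eq373DerivativeRemainderL2 (norm_covDivL2K_sub_le)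
open B9Eq373DerivativeRemainderTwoBackgrounds (norm_covDivL2K_sub_le₂)
open B9Eq384RemainderLetters (norm_adTransportW_sub_le)
open B9Eq368RLipschitzTwoBackgrounds (norm_adTransportW_sub_adTransportW_le)
open B9Eq368ProjectionRemainder (norm_projR_le)
open B9Eq325RLipschitzSqrtTowerLinear (prod_profile_sub_one_le_linear)
open B9Eq325RLipschitzSqrtTowerTwoBackgroundsDiagonal (norm_covDerivL2K_sub_le_diagonal₂)
open B9Eq325RLipschitzSqrtTowerTwoBackgroundsLinear (exists_norm_RofUk_sub_RofUk_le_two_backgrounds)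
open B9Eq319QprimeTowerLipschitzL2TwoBackgroundsChain (norm_QtildeTower_sub_QtildeTower_le_linear norm_QtildeTower_le)
open B9Eq386GreenLipschitzEnergy (norm_inner_sub_inner_le weight_green_le weight_green_sub_le)

variable {d : ℕ} (L : ℕ) [NeZero L]
  {𝔸 : Type*} [NormedRing 𝔸] [NormedAlgebra ℂ 𝔸] [CompleteSpace 𝔸] [NormOneClass 𝔸]
  {W : Type*} [NormedAddCommGroup W] [InnerProductSpace ℂ W] [FiniteDimensional ℂ W] (φ : W ≃ₗ[ℂ] 𝔸)
  {Mφ Mφ' : ℝ} (hMφ : 0 ≤ Mφ) (hMφ' : 0 ≤ Mφ') (hφ : ∀ w, ‖φ w‖ ≤ Mφ * ‖w‖) (hφ' : ∀ X, ‖φ.symm X‖ ≤ Mφ' * ‖X‖)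
  {a' : ℝ} (ha' : 0 < a') {r : ℝ} (hr0 : 0 ≤ r) (hr1 : r < 1)

/-! ## §1 Arithmetic and the polarised form of `Δ′_{a′,k}` -/

omit [NeZero L] in
/-- `x ≤ √S` from `0 ≤ x` and `x² ≤ S`. [folklore] -/
private theorem le_sqrt_of_sq_le {x S : ℝ} (hx : 0 ≤ x) (h : x ^ 2 ≤ S) : x ≤ Real.sqrt S := by
  calc x = Real.sqrt (x ^ 2) := (Real.sqrt_sq hx).symm
    _ ≤ Real.sqrt S := Real.sqrt_le_sqrt h

omit [NeZero L] in
/-- On the diagonal `c₀(L^{n+1})^d = c₁` the weighted-reading prefactor is `1`. [cite: Balaban1985BackgroundPropagators, (3.16) p.393] -/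
private theorem sqrt_ratio_diagonal {n : ℕ} {c₀ c₁ : ℝ} (hc₁ : 0 < c₁) (hw : c₀ * ((L : ℝ) ^ (n + 1)) ^ d = c₁) :
    Real.sqrt (c₁ / (c₀ * ((L : ℝ) ^ (n + 1)) ^ d)) = 1 := by
  rw [hw, div_self hc₁.ne', Real.sqrt_one]

omit [NormOneClass 𝔸] in
/-- **THE POLARISED FORM of (3.24) at `k` levels: `⟨u, Δ′_{a′,k}(X)v⟩ = ⟨D_Xu, D_Xv⟩ + a′⟨Q̃′_k(X)u, Q̃′_k(X)v⟩`** for mutually adjoint transporters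
(`D*_X = D_X†`). [cite: Balaban1985BackgroundPropagators, (3.23)–(3.24) p.394] -/
theorem inner_laplacePrimeAk_eq (m : Fin d → ℕ) [∀ i, NeZero (m i)] (n : ℕ) {c₀ : ℝ} [Fact (0 < c₀)] (η : ℝ)
    (X : Bond d (towerP L m (n + 1)) → 𝔸ˣ) {c₁ : ℝ} [Fact (0 < c₁)] (a' : ℝ)
    (hRS : ∀ (b : Bond d (towerP L m (n + 1))) (v u : W), ⟪adTransportW φ X b v, u⟫_ℂ = ⟪v, adTransportW φ (fun b => (X b)⁻¹) b u⟫_ℂ)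
    (u v : SiteL2K ℂ d (towerP L m (n + 1)) c₀ W) :
    ⟪u, laplacePrimeAk L m n φ η X a' (c₁ := c₁) v⟫_ℂ =
      ⟪covDerivL2K ℂ c₀ ((η : ℂ))⁻¹ (adTransportW φ X) u, covDerivL2K ℂ c₀ ((η : ℂ))⁻¹ (adTransportW φ X) v⟫_ℂ +
        (a' : ℂ) * ⟪((WL2.linearEquiv ℂ ℂ (fun _ : TSite d m => c₁)).symm.toLinearMap ∘ₗ QprimeTowerW L m n φ X) u,
          ((WL2.linearEquiv ℂ ℂ (fun _ : TSite d m => c₁)).symm.toLinearMap ∘ₗ QprimeTowerW L m n φ X) v⟫_ℂ := by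
  have hc : conj (((η : ℂ))⁻¹) = ((η : ℂ))⁻¹ := by rw [map_inv₀, Complex.conj_ofReal]
  rw [laplacePrimeAk, LinearMap.add_apply, inner_add_right]
  congr 1
  · rw [covLaplaceSiteK, LinearMap.comp_apply, ← adjoint_covDerivL2K _ hc _ _ hRS, LinearMap.adjoint_inner_right]
  · rw [LinearMap.smul_apply, inner_smul_right, LinearMap.comp_apply, LinearMap.adjoint_inner_right]

/-! ## §2 The gauge-mode letter between two backgrounds -/

set_option maxHeartbeats 800000 in
include hMφ hMφ' hφ hφ' ha' hr0 hr1 in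
/-- **THE GAUGE-MODE LETTER IS LIPSCHITZ IN THE BACKGROUND**: `∃ α₀ δ₀ C > 0` (closed in `(d, L, M_φ, M_φ′, a′, r)`) before every lattice ∕ height ∕ volume ∕
background binder; then on the diagonal, for `U`, `V` in the bond windows `αη`, `δη`-close, with `U1`-valued level averages in the profiles `ε_j ≤ αr^j`,
`δ_j ≤ δr^j`, mutually adjoint transporters and ANY positivity witnesses of `Δ′_{a′,k}(U)`, `Δ′_{a′,k}(V)`: `‖λ_U(w) − λ_V(w)‖ ≤ C·δ·N₁(w)` and
`‖D_Uλ_U(w) − D_Vλ_V(w)‖ ≤ C·δ·N₁(w)`, `λ_X(w) = G′_k(X)(R_k(X)(D*_Xw))`.  Resolvent route `λ_U − λ_V = (G′_U − G′_V)y_U + G′_V(y_U − y_V)` in the flat site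
weight; the two-background `R_k`, `D`, `D*`, `Q̃′_k` letters BY NAME. [folklore]
[cite: Balaban1985BackgroundPropagators, (3.21)–(3.25) p.394, Thm 3.4 p.400, (3.84)–(3.86) p.407, (3.119)–(3.120) p.419, Thm 3.11 p.416, (3.35) p.396] -/
theorem exists_gaugeMode_letters_two_backgrounds :
    ∃ α₀ δ₀ C : ℝ, 0 < α₀ ∧ 0 < δ₀ ∧ 0 < C ∧ ∀ (n : ℕ) (η : ℝ), η * (L : ℝ) ^ (n + 1) = 1 →
      ∀ (c₀ c₁ : ℝ) [Fact (0 < c₀)] [Fact (0 < c₁)], c₀ * ((L : ℝ) ^ (n + 1)) ^ d = c₁ →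
      ∀ (m : Fin d → ℕ) [∀ i, NeZero (m i)] (U V : Bond d (towerP L m (n + 1)) → 𝔸ˣ),
        (∀ (b : Bond d (towerP L m (n + 1))) (v u : W), ⟪adTransportW φ U b v, u⟫_ℂ = ⟪v, adTransportW φ (fun b => (U b)⁻¹) b u⟫_ℂ) →
        (∀ (b : Bond d (towerP L m (n + 1))) (v u : W), ⟪adTransportW φ V b v, u⟫_ℂ = ⟪v, adTransportW φ (fun b => (V b)⁻¹) b u⟫_ℂ) →
      ∀ (α δ : ℝ), 0 ≤ α → α ≤ α₀ → 0 ≤ δ → δ ≤ δ₀ →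
        (∀ b, U b ∈ U1 𝔸) → (∀ b, V b ∈ U1 𝔸) → (∀ b, ‖(U b : 𝔸) - 1‖ ≤ α * η) → (∀ b, ‖(V b : 𝔸) - 1‖ ≤ α * η) →
        (∀ b, ‖(U b : 𝔸) - (V b : 𝔸)‖ ≤ δ * η) →
      ∀ (εU δUV : ℕ → ℝ), (∀ j, 0 ≤ εU j) → (∀ j, 0 ≤ δUV j) → (∀ j < n + 1, εU j ≤ α * r ^ j) → (∀ j < n + 1, δUV j ≤ δ * r ^ j) →
        (∀ (j : ℕ) (b : Bond d (towerP L m (j + 1))), ‖(UlevOf L m (n + 1) U j b : 𝔸) - 1‖ ≤ εU j) →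
        (∀ (j : ℕ) (b : Bond d (towerP L m (j + 1))), ‖(UlevOf L m (n + 1) V j b : 𝔸) - 1‖ ≤ εU j) →
        (∀ (j : ℕ) (b : Bond d (towerP L m (j + 1))), UlevOf L m (n + 1) U j b ∈ U1 𝔸) →
        (∀ (j : ℕ) (b : Bond d (towerP L m (j + 1))), UlevOf L m (n + 1) V j b ∈ U1 𝔸) →
        (∀ (j : ℕ) (b : Bond d (towerP L m (j + 1))), ‖(UlevOf L m (n + 1) U j b : 𝔸) - (UlevOf L m (n + 1) V j b : 𝔸)‖ ≤ δUV j) →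
      ∀ (hposU : ∀ x : SiteL2K ℂ d (towerP L m (n + 1)) c₀ W, x ≠ 0 → 0 < RCLike.re ⟪x, laplacePrimeAk L m n φ η U a' (c₁ := c₁) x⟫_ℂ)
        (hposV : ∀ x : SiteL2K ℂ d (towerP L m (n + 1)) c₀ W, x ≠ 0 → 0 < RCLike.re ⟪x, laplacePrimeAk L m n φ η V a' (c₁ := c₁) x⟫_ℂ)
        (w : BondL2K ℂ d (towerP L m (n + 1)) c₀ W),
        ‖GpOfUk L m n φ η U a' hposU (RofUk L m n φ η U (covDivL2K ℂ c₀ ((η : ℂ))⁻¹ (adTransportW φ fun b => (U b)⁻¹) w)) -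
            GpOfUk L m n φ η V a' hposV (RofUk L m n φ η V (covDivL2K ℂ c₀ ((η : ℂ))⁻¹ (adTransportW φ fun b => (V b)⁻¹) w))‖ ≤
          C * δ * Real.sqrt (‖covCurlL2K ℂ c₀ ((η : ℂ))⁻¹ (adTransportW φ (fun _ : Bond d (towerP L m (n + 1)) => (1 : 𝔸ˣ))) w‖ ^ 2 +
            ‖covDivL2K ℂ c₀ ((η : ℂ))⁻¹ (adTransportW φ fun _ : Bond d (towerP L m (n + 1)) => (1 : 𝔸ˣ)⁻¹) w‖ ^ 2 + ‖w‖ ^ 2) ∧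
        ‖covDerivL2K ℂ c₀ ((η : ℂ))⁻¹ (adTransportW φ U)
              (GpOfUk L m n φ η U a' hposU (RofUk L m n φ η U (covDivL2K ℂ c₀ ((η : ℂ))⁻¹ (adTransportW φ fun b => (U b)⁻¹) w))) -
            covDerivL2K ℂ c₀ ((η : ℂ))⁻¹ (adTransportW φ V)
              (GpOfUk L m n φ η V a' hposV (RofUk L m n φ η V (covDivL2K ℂ c₀ ((η : ℂ))⁻¹ (adTransportW φ fun b => (V b)⁻¹) w)))‖ ≤
          C * δ * Real.sqrt (‖covCurlL2K ℂ c₀ ((η : ℂ))⁻¹ (adTransportW φ (fun _ : Bond d (towerP L m (n + 1)) => (1 : 𝔸ˣ))) w‖ ^ 2 +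
            ‖covDivL2K ℂ c₀ ((η : ℂ))⁻¹ (adTransportW φ fun _ : Bond d (towerP L m (n + 1)) => (1 : 𝔸ˣ)⁻¹) w‖ ^ 2 + ‖w‖ ^ 2) := by
  obtain ⟨α₁, γ', hα₁, hγ', HC⟩ := exists_strong_site_coercive_tower_diagonal (d := d) L φ hMφ hMφ' hφ hφ' ha' hr0 hr1
  obtain ⟨αR, CR, hαR, hCR, HR⟩ := exists_norm_RofUk_sub_RofUk_le_two_backgrounds (d := d) L φ hMφ hMφ' hφ hφ' hr0 hr1
  have h1r : 0 < 1 - r := by linarith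
  have hMM : 0 ≤ 2 * Mφ * Mφ' := by positivity
  -- the closed letters (opaque reals with their defining equations)
  obtain ⟨sD, hsD⟩ : ∃ x : ℝ, x = Real.sqrt d * (2 * Mφ * Mφ') := ⟨_, rfl⟩
  have hsD0 : 0 ≤ sD := by rw [hsD]; positivity
  obtain ⟨K, hKdef⟩ : ∃ x : ℝ, x = 1 + sD := ⟨_, rfl⟩
  have hK0 : 0 ≤ K := by rw [hKdef]; positivity
  obtain ⟨cP, hcP⟩ : ∃ x : ℝ, x = ((d * (L - 1) : ℕ) : ℝ) * (2 * Mφ * Mφ') / (1 - r) := ⟨_, rfl⟩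
  have hcP0 : 0 ≤ cP := by rw [hcP]; positivity
  obtain ⟨BQ, hBQ⟩ : ∃ x : ℝ, x = ((d * (L - 1) : ℕ) : ℝ) * (2 * Mφ * Mφ') * (1 + 2 * Mφ * Mφ' * 1) ^ (d * (L - 1)) / (1 - r) := ⟨_, rfl⟩
  have hBQ0 : 0 ≤ BQ := by rw [hBQ]; positivity
  obtain ⟨sQ, hsQ⟩ : ∃ x : ℝ, x = 2 * Real.exp (((d * (L - 1) : ℕ) : ℝ) * (2 * Mφ * Mφ' * 1 / (1 - r))) * BQ := ⟨_, rfl⟩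
  have hsQ0 : 0 ≤ sQ := by rw [hsQ]; positivity
  obtain ⟨Θb, hΘb⟩ : ∃ x : ℝ, x = sD * (2 * K + sD) + a' * (sQ * (2 * 3 + sQ)) := ⟨_, rfl⟩
  have hΘb0 : 0 ≤ Θb := by rw [hΘb]; positivity
  have hγi : 0 ≤ γ'⁻¹ := inv_nonneg.2 hγ'.le
  obtain ⟨C, hCdef⟩ : ∃ x : ℝ, x = (1 + sD) * (Θb * K * γ'⁻¹ * γ'⁻¹ + γ'⁻¹ * (CR * K + sD)) + sD * (γ'⁻¹ * K) + 1 := ⟨_, rfl⟩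
  have hCpos : 0 < C := by rw [hCdef]; positivity
  refine ⟨min (min α₁ αR) (min 1 (1 / (cP + 1))), min 1 (1 / (BQ + 1)), C, lt_min (lt_min hα₁ hαR) (lt_min one_pos (by positivity)),
    lt_min one_pos (by positivity), hCpos, ?_⟩
  intro n η hηL c₀ c₁ _ _ hw m _ U V hRSU hRSV α δ hα0 hαle hδ0 hδle hUb hVb hUη hVη hUV εU δUV hεU hδUV hεg hδg hLεU hLεV hLbU hLbV hLUV
    hposU hposV w
  /- §A real arithmetic first (small context) -/
  have hc₁ : 0 < c₁ := Fact.out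
  have hα₁' : α ≤ α₁ := hαle.trans ((min_le_left _ _).trans (min_le_left _ _))
  have hαR' : α ≤ αR := hαle.trans ((min_le_left _ _).trans (min_le_right _ _))
  have hα1 : α ≤ 1 := hαle.trans ((min_le_right _ _).trans (min_le_left _ _))
  have hαP : cP * α ≤ 1 := by
    have h1 : α ≤ 1 / (cP + 1) := hαle.trans ((min_le_right _ _).trans (min_le_right _ _))
    calc cP * α ≤ cP * (1 / (cP + 1)) := mul_le_mul_of_nonneg_left h1 hcP0
      _ ≤ 1 := by rw [mul_one_div, div_le_one (by positivity)]; linarith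
  have h2P : 1 + 2 * cP * α ≤ 3 := by nlinarith
  have hδ1 : δ ≤ 1 := hδle.trans (min_le_left _ _)
  have hδB : BQ * δ ≤ 1 := by
    have h1 : δ ≤ 1 / (BQ + 1) := hδle.trans (min_le_right _ _)
    calc BQ * δ ≤ BQ * (1 / (BQ + 1)) := mul_le_mul_of_nonneg_left h1 hBQ0
      _ ≤ 1 := by rw [mul_one_div, div_le_one (by positivity)]; linarith
  have hαm : 2 * Mφ * Mφ' * α ≤ 2 * Mφ * Mφ' * 1 := mul_le_mul_of_nonneg_left hα1 hMM
  have hαm1 : 1 + 2 * Mφ * Mφ' * α ≤ 1 + 2 * Mφ * Mφ' * 1 := by linarith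
  have hB : ((d * (L - 1) : ℕ) * (2 * Mφ * Mφ') * (1 + 2 * Mφ * Mφ' * α) ^ (d * (L - 1)) / (1 - r)) ≤ BQ := by
    rw [hBQ]
    exact div_le_div_of_nonneg_right (mul_le_mul_of_nonneg_left
      (pow_le_pow_left₀ (by positivity) hαm1 _) (by positivity)) h1r.le
  have hwin : ((d * (L - 1) : ℕ) * (2 * Mφ * Mφ') * (1 + 2 * Mφ * Mφ' * α) ^ (d * (L - 1)) / (1 - r)) * δ ≤ 1 :=
    (mul_le_mul_of_nonneg_right hB hδ0).trans hδB
  have hsQ' : 2 * Real.exp (((d * (L - 1) : ℕ) : ℝ) * (2 * Mφ * Mφ' * α / (1 - r))) *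
      ((d * (L - 1) : ℕ) * (2 * Mφ * Mφ') * (1 + 2 * Mφ * Mφ' * α) ^ (d * (L - 1)) / (1 - r)) * δ ≤ sQ * δ := by
    rw [hsQ]
    have hexp : Real.exp (((d * (L - 1) : ℕ) : ℝ) * (2 * Mφ * Mφ' * α / (1 - r))) ≤
        Real.exp (((d * (L - 1) : ℕ) : ℝ) * (2 * Mφ * Mφ' * 1 / (1 - r))) :=
      Real.exp_le_exp.2 (mul_le_mul_of_nonneg_left (div_le_div_of_nonneg_right hαm h1r.le) (Nat.cast_nonneg _))
    exact mul_le_mul_of_nonneg_right (mul_le_mul (mul_le_mul_of_nonneg_left hexp (by norm_num)) hB (by positivity) (by positivity)) hδ0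
  have hs1 : sD * δ * (2 * K + sD * δ) ≤ δ * (sD * (2 * K + sD)) := by
    have key : sD * sD * δ * δ ≤ sD * sD * δ * 1 := mul_le_mul_of_nonneg_left hδ1 (by positivity)
    nlinarith [key]
  have hs2 : sQ * δ * (2 * 3 + sQ * δ) ≤ δ * (sQ * (2 * 3 + sQ)) := by
    have key : sQ * sQ * δ * δ ≤ sQ * sQ * δ * 1 := mul_le_mul_of_nonneg_left hδ1 (by positivity)
    nlinarith [key]
  have hLr : (0 : ℝ) < (L : ℝ) ^ (n + 1) := pow_pos (by exact_mod_cast Nat.pos_of_ne_zero (NeZero.ne L)) _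
  have hη0 : 0 < η := pos_of_mul_pos_left (by rw [hηL]; exact one_pos) hLr.le
  have hc : conj (((η : ℂ))⁻¹) = ((η : ℂ))⁻¹ := by rw [map_inv₀, Complex.conj_ofReal]
  have hηn : ‖((η : ℂ))⁻¹‖ * η = 1 := by rw [norm_inv, Complex.norm_real, Real.norm_eq_abs, abs_of_pos hη0, inv_mul_cancel₀ hη0.ne']
  have hone : Real.sqrt (c₁ / (c₀ * ((L : ℝ) ^ (n + 1)) ^ d)) = 1 := sqrt_ratio_diagonal L hc₁ hw
  have hηα : ‖((η : ℂ))⁻¹‖ * (2 * Mφ * Mφ' * (α * η)) * Real.sqrt d = sD * α := by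
    rw [hsD]; calc _ = Real.sqrt d * (2 * Mφ * Mφ') * α * (‖((η : ℂ))⁻¹‖ * η) := by ring
      _ = _ := by rw [hηn, mul_one]
  have hηδ : ‖((η : ℂ))⁻¹‖ * (2 * Mφ * Mφ' * (δ * η)) * Real.sqrt d = sD * δ := by
    rw [hsD]; calc _ = Real.sqrt d * (2 * Mφ * Mφ') * δ * (‖((η : ℂ))⁻¹‖ * η) := by ring
      _ = _ := by rw [hηn, mul_one]
  -- §B the flat SITE weight `N(λ) = √(‖D_1λ‖² + ‖λ‖²)` and the flat BOND weight `N₁(w)`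
  obtain ⟨N, hNdef⟩ : ∃ N : SiteL2K ℂ d (towerP L m (n + 1)) c₀ W → ℝ, N = fun z =>
      Real.sqrt (‖covDerivL2K ℂ c₀ ((η : ℂ))⁻¹ (adTransportW φ (fun _ : Bond d (towerP L m (n + 1)) => (1 : 𝔸ˣ))) z‖ ^ 2 + ‖z‖ ^ 2) := ⟨_, rfl⟩
  have hNz : ∀ z, N z = Real.sqrt (‖covDerivL2K ℂ c₀ ((η : ℂ))⁻¹ (adTransportW φ (fun _ : Bond d (towerP L m (n + 1)) => (1 : 𝔸ˣ))) z‖ ^ 2 + ‖z‖ ^ 2) := fun z => by rw [hNdef]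
  have hN0 : ∀ z, 0 ≤ N z := fun z => by rw [hNz]; exact Real.sqrt_nonneg _
  have hNsq : ∀ z, N z ^ 2 = ‖covDerivL2K ℂ c₀ ((η : ℂ))⁻¹ (adTransportW φ (fun _ : Bond d (towerP L m (n + 1)) => (1 : 𝔸ˣ))) z‖ ^ 2 + ‖z‖ ^ 2 :=
    fun z => by rw [hNz]; exact Real.sq_sqrt (add_nonneg (sq_nonneg _) (sq_nonneg _))
  have hNn : ∀ z, ‖z‖ ≤ N z := fun z => by rw [hNz]; exact le_sqrt_of_sq_le (norm_nonneg _) (le_add_of_nonneg_left (sq_nonneg _))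
  have hND : ∀ z, ‖covDerivL2K ℂ c₀ ((η : ℂ))⁻¹ (adTransportW φ (fun _ : Bond d (towerP L m (n + 1)) => (1 : 𝔸ˣ))) z‖ ≤ N z :=
    fun z => by rw [hNz]; exact le_sqrt_of_sq_le (norm_nonneg _) (le_add_of_nonneg_right (sq_nonneg _))
  obtain ⟨N₁, hN₁def⟩ : ∃ x : ℝ, x = Real.sqrt (‖covCurlL2K ℂ c₀ ((η : ℂ))⁻¹ (adTransportW φ (fun _ : Bond d (towerP L m (n + 1)) => (1 : 𝔸ˣ))) w‖ ^ 2 +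
      ‖covDivL2K ℂ c₀ ((η : ℂ))⁻¹ (adTransportW φ fun _ : Bond d (towerP L m (n + 1)) => (1 : 𝔸ˣ)⁻¹) w‖ ^ 2 + ‖w‖ ^ 2) := ⟨_, rfl⟩
  have hN₁0 : 0 ≤ N₁ := by rw [hN₁def]; exact Real.sqrt_nonneg _
  have hN₁w : ‖w‖ ≤ N₁ := by rw [hN₁def]; exact le_sqrt_of_sq_le (norm_nonneg _) (le_add_of_nonneg_left (add_nonneg (sq_nonneg _) (sq_nonneg _)))
  have hN₁d : ‖covDivL2K ℂ c₀ ((η : ℂ))⁻¹ (adTransportW φ fun _ : Bond d (towerP L m (n + 1)) => (1 : 𝔸ˣ)⁻¹) w‖ ≤ N₁ := by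
    rw [hN₁def]; exact le_sqrt_of_sq_le (norm_nonneg _) ((le_add_of_nonneg_left (sq_nonneg _)).trans (le_add_of_nonneg_right (sq_nonneg _)))
  rw [← hN₁def]
  /- §C the SITE derivative letters (`η`-free): `D_U` against `D_1` (window `αη`), `D_U` against `D_V` (closeness `δη`) -/
  have h1b : ∀ b : Bond d (towerP L m (n + 1)), ((fun _ : Bond d (towerP L m (n + 1)) => (1 : 𝔸ˣ)) b) ∈ U1 𝔸 := fun _ => (U1 𝔸).one_mem
  have hU1c : ∀ b, ‖(U b : 𝔸) - (((fun _ : Bond d (towerP L m (n + 1)) => (1 : 𝔸ˣ)) b : 𝔸ˣ) : 𝔸)‖ ≤ α * η := fun b => by rw [Units.val_one]; exact hUη b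
  have hVUc : ∀ b : Bond d (towerP L m (n + 1)), ‖(V b : 𝔸) - (U b : 𝔸)‖ ≤ δ * η := fun b => by rw [norm_sub_rev]; exact hUV b
  have hDU1 : ∀ l : SiteL2K ℂ d (towerP L m (n + 1)) c₀ W, ‖covDerivL2K ℂ c₀ ((η : ℂ))⁻¹ (adTransportW φ U) l -
      covDerivL2K ℂ c₀ ((η : ℂ))⁻¹ (adTransportW φ (fun _ : Bond d (towerP L m (n + 1)) => (1 : 𝔸ˣ))) l‖ ≤ (sD * α) * ‖l‖ := fun l => by
    have h := norm_covDerivL2K_sub_le_diagonal₂ L m n φ hMφ hMφ' hφ hφ' c₀ η hηL U (fun _ => 1) hα0 hUb h1b hU1c l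
    rw [hsD]; exact h.trans_eq (by ring)
  have hDVU : ∀ l : SiteL2K ℂ d (towerP L m (n + 1)) c₀ W, ‖covDerivL2K ℂ c₀ ((η : ℂ))⁻¹ (adTransportW φ V) l -
      covDerivL2K ℂ c₀ ((η : ℂ))⁻¹ (adTransportW φ U) l‖ ≤ (sD * δ) * N l := fun l => by
    have h := norm_covDerivL2K_sub_le_diagonal₂ L m n φ hMφ hMφ' hφ hφ' c₀ η hηL V U hδ0 hVb hUb hVUc l
    rw [hsD]
    exact h.trans ((le_of_eq (by ring)).trans (mul_le_mul_of_nonneg_left (hNn l) (by positivity)))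
  have hDUV : ∀ l : SiteL2K ℂ d (towerP L m (n + 1)) c₀ W, ‖covDerivL2K ℂ c₀ ((η : ℂ))⁻¹ (adTransportW φ U) l -
      covDerivL2K ℂ c₀ ((η : ℂ))⁻¹ (adTransportW φ V) l‖ ≤ (sD * δ) * ‖l‖ := fun l => by
    have h := norm_covDerivL2K_sub_le_diagonal₂ L m n φ hMφ hMφ' hφ hφ' c₀ η hηL U V hδ0 hUb hVb hUV l
    rw [hsD]; exact h.trans_eq (by ring)
  have hDU : ∀ l : SiteL2K ℂ d (towerP L m (n + 1)) c₀ W, ‖covDerivL2K ℂ c₀ ((η : ℂ))⁻¹ (adTransportW φ U) l‖ ≤ K * N l := fun l => by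
    have h1 := norm_le_insert' (covDerivL2K ℂ c₀ ((η : ℂ))⁻¹ (adTransportW φ U) l)
      (covDerivL2K ℂ c₀ ((η : ℂ))⁻¹ (adTransportW φ (fun _ : Bond d (towerP L m (n + 1)) => (1 : 𝔸ˣ))) l)
    have h2 : (sD * α) * ‖l‖ ≤ sD * N l := by
      calc (sD * α) * ‖l‖ ≤ (sD * 1) * N l := mul_le_mul (mul_le_mul_of_nonneg_left hα1 hsD0) (hNn l) (norm_nonneg _) (by positivity)
        _ = sD * N l := by ring
    rw [hKdef]; linarith only [h1, h2, hDU1 l, hND l]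
  /- §D the `Q̃′_k` letters: `≤ 3N(l)` and the two-background defect `≤ s_Qδ·N(l)` -/
  have hprod : (∏ j ∈ Finset.range (n + 1), (1 + 2 * Mφ * Mφ' * εU j) ^ (d * (L - 1))) ≤ 3 := by
    have hc1 : ((d * (L - 1) : ℕ) : ℝ) * (2 * Mφ * Mφ') / (1 - r) * α ≤ 1 := by rw [← hcP]; exact hαP
    have h := prod_profile_sub_one_le_linear L (d := d) (n := n) hMM hr0 hr1 hα0 εU hεU hεg hc1
    rw [← hcP] at h
    linarith only [h, h2P]
  have hQU : ∀ l : SiteL2K ℂ d (towerP L m (n + 1)) c₀ W,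
      ‖((WL2.linearEquiv ℂ ℂ (fun _ : TSite d m => c₁)).symm.toLinearMap ∘ₗ QprimeTowerW L m n φ U (c₀ := c₀)) l‖ ≤ 3 * N l := fun l => by
    have h := norm_QtildeTower_le L m n φ hMφ hMφ' hφ hφ' (c₀ := c₀) c₁ U εU hεU hLεU hLbU l
    rw [hone, mul_one] at h
    exact h.trans (mul_le_mul hprod (hNn l) (norm_nonneg _) (by norm_num))
  have hQVU : ∀ l : SiteL2K ℂ d (towerP L m (n + 1)) c₀ W,
      ‖((WL2.linearEquiv ℂ ℂ (fun _ : TSite d m => c₁)).symm.toLinearMap ∘ₗ QprimeTowerW L m n φ V (c₀ := c₀)) l -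
        ((WL2.linearEquiv ℂ ℂ (fun _ : TSite d m => c₁)).symm.toLinearMap ∘ₗ QprimeTowerW L m n φ U (c₀ := c₀)) l‖ ≤ (sQ * δ) * N l := fun l => by
    have h := norm_QtildeTower_sub_QtildeTower_le_linear L m n φ hMφ hMφ' hφ hφ' (c₀ := c₀) c₁ U V εU δUV hεU hδUV hLεU hLεV hLbU hLbV hLUV hr0 hr1
      hα0 hδ0 hεg hδg hwin l
    rw [hone, mul_one, norm_sub_rev] at h
    exact h.trans ((mul_le_mul_of_nonneg_right hsQ' (norm_nonneg _)).trans (mul_le_mul_of_nonneg_left (hNn l) (by positivity)))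
  /- §E the site FORM DEFECT `‖⟨u, Δ′_Vv⟩ − ⟨u, Δ′_Uv⟩‖ ≤ Θ̄δ·N(u)N(v)` -/
  have hΘδ : 0 ≤ Θb * δ := mul_nonneg hΘb0 hδ0
  have hT : ∀ u v : SiteL2K ℂ d (towerP L m (n + 1)) c₀ W,
      ‖⟪u, laplacePrimeAk L m n φ η V a' (c₁ := c₁) v⟫_ℂ - ⟪u, laplacePrimeAk L m n φ η U a' (c₁ := c₁) v⟫_ℂ‖ ≤ (Θb * δ) * N u * N v := by
    intro u v
    have t1 := norm_inner_sub_inner_le (𝕜 := ℂ) (fun z => covDerivL2K ℂ c₀ ((η : ℂ))⁻¹ (adTransportW φ V) z)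
      (fun z => covDerivL2K ℂ c₀ ((η : ℂ))⁻¹ (adTransportW φ U) z) N hN0 (by positivity : 0 ≤ sD * δ) hK0 hDVU hDU u v
    have t2 := norm_inner_sub_inner_le (𝕜 := ℂ)
      (fun z => ((WL2.linearEquiv ℂ ℂ (fun _ : TSite d m => c₁)).symm.toLinearMap ∘ₗ QprimeTowerW L m n φ V (c₀ := c₀)) z)
      (fun z => ((WL2.linearEquiv ℂ ℂ (fun _ : TSite d m => c₁)).symm.toLinearMap ∘ₗ QprimeTowerW L m n φ U (c₀ := c₀)) z)
      N hN0 (by positivity : 0 ≤ sQ * δ) (by norm_num : (0:ℝ) ≤ 3) hQVU hQU u v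
    rw [inner_laplacePrimeAk_eq L φ m n η V a' hRSV u v, inner_laplacePrimeAk_eq L φ m n η U a' hRSU u v, add_sub_add_comm, ← mul_sub]
    have ha'n : ‖(a' : ℂ)‖ = a' := by rw [Complex.norm_real, Real.norm_eq_abs, abs_of_pos ha']
    have hNN : 0 ≤ N u * N v := mul_nonneg (hN0 u) (hN0 v)
    have T1 := (t1.trans_eq (mul_assoc _ _ _)).trans (mul_le_mul_of_nonneg_right hs1 hNN)
    have T2 := (t2.trans_eq (mul_assoc _ _ _)).trans (mul_le_mul_of_nonneg_right hs2 hNN)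
    refine (norm_add_le _ _).trans ?_
    rw [norm_mul, ha'n]
    refine (add_le_add T1 (mul_le_mul_of_nonneg_left T2 ha'.le)).trans_eq ?_
    rw [hΘb]; ring
  have hcoerU : ∀ z, γ' * N z ^ 2 ≤ RCLike.re ⟪z, laplacePrimeAk L m n φ η U a' (c₁ := c₁) z⟫_ℂ :=
    fun z => by rw [hNsq]; exact HC n η hηL c₀ c₁ hw m U hRSU α hα0 hα₁' hUb hUη εU hεU hεg hLεU hLbU z
  have hcoerV : ∀ z, γ' * N z ^ 2 ≤ RCLike.re ⟪z, laplacePrimeAk L m n φ η V a' (c₁ := c₁) z⟫_ℂ :=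
    fun z => by rw [hNsq]; exact HC n η hηL c₀ c₁ hw m V hRSV α hα0 hα₁' hVb hVη εU hεU hεg hLεV hLbV z
  have hGU := fun y => weight_green_le (𝕜 := ℂ) hposU N hN0 hNn hγ' hcoerU y
  have hGV := fun y => weight_green_le (𝕜 := ℂ) hposV N hN0 hNn hγ' hcoerV y
  have hGsub := fun y => weight_green_sub_le (𝕜 := ℂ) hposU hposV N hN0 hγ' hΘδ hcoerV hT y
  /- §G the `D*` letters and the `y`-letters `y_X = R_k(X)(D*_Xw)` -/
  have hR := fun (b : Bond d (towerP L m (n + 1))) (v : W) => norm_adTransportW_sub_le φ hφ hφ' hMφ' U b (hUb b) (hUη b) v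
  have hRV := fun (b : Bond d (towerP L m (n + 1))) (v : W) => norm_adTransportW_sub_le φ hφ hφ' hMφ' V b (hVb b) (hVη b) v
  have hR₁ : ∀ (b : Bond d (towerP L m (n + 1))) (v : W), adTransportW φ (fun _ : Bond d (towerP L m (n + 1)) => (1 : 𝔸ˣ)) b v = v := fun b v => by rw [adTransportW_one]; rfl
  have hS₁ : ∀ (b : Bond d (towerP L m (n + 1))) (v : W), adTransportW φ (fun _ : Bond d (towerP L m (n + 1)) => (1 : 𝔸ˣ)⁻¹) b v = v := fun b v => by rw [adTransportW_inv_one]; rfl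
  have hεR : 0 ≤ 2 * Mφ * Mφ' * (α * η) := by positivity
  have hDsU1 := norm_covDivL2K_sub_le (𝕜 := ℂ) (c₀ := c₀) ((η : ℂ))⁻¹ hc hεR hR hR₁ hRSU hS₁ w
  have hDsV1 := norm_covDivL2K_sub_le (𝕜 := ℂ) (c₀ := c₀) ((η : ℂ))⁻¹ hc hεR hRV hR₁ hRSV hS₁ w
  rw [hηα] at hDsU1 hDsV1
  have hKN : sD * α * ‖w‖ ≤ sD * N₁ := by
    calc sD * α * ‖w‖ ≤ sD * 1 * N₁ := by
          rw [mul_assoc, mul_assoc]; exact mul_le_mul_of_nonneg_left (mul_le_mul hα1 hN₁w (norm_nonneg _) zero_le_one) hsD0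
      _ = sD * N₁ := by ring
  set dU := covDivL2K ℂ c₀ ((η : ℂ))⁻¹ (adTransportW φ fun b => (U b)⁻¹) w with hdU
  set dV := covDivL2K ℂ c₀ ((η : ℂ))⁻¹ (adTransportW φ fun b => (V b)⁻¹) w with hdV
  have hDsU : ‖dU‖ ≤ K * N₁ := by
    have h1 := norm_le_insert' dU (covDivL2K ℂ c₀ ((η : ℂ))⁻¹ (adTransportW φ fun _ : Bond d (towerP L m (n + 1)) => (1 : 𝔸ˣ)⁻¹) w)
    rw [hKdef]; linarith only [h1, hDsU1, hN₁d, hKN]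
  have hDsV : ‖dV‖ ≤ K * N₁ := by
    have h1 := norm_le_insert' dV (covDivL2K ℂ c₀ ((η : ℂ))⁻¹ (adTransportW φ fun _ : Bond d (towerP L m (n + 1)) => (1 : 𝔸ˣ)⁻¹) w)
    rw [hKdef]; linarith only [h1, hDsV1, hN₁d, hKN]
  have hRR' := fun (b : Bond d (towerP L m (n + 1))) (v : W) => norm_adTransportW_sub_adTransportW_le L (towerP L m n) φ hφ hφ' hMφ' U V b (hUb b) (hVb b) (hUV b) v
  have hDsUV : ‖dU - dV‖ ≤ (sD * δ) * ‖w‖ := by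
    have h := norm_covDivL2K_sub_le₂ (𝕜 := ℂ) (c₀ := c₀) ((η : ℂ))⁻¹ hc (by positivity : 0 ≤ 2 * Mφ * Mφ' * (δ * η)) hRR' hRSU hRSV w
    rw [hηδ] at h; exact h
  have hR2 := HR n η hηL c₀ c₁ hw m U V εU δUV hεU hδUV hLεU hLεV hLbU hLbV hLUV hα0 hαR' hδ0 hRSU hRSV hUb hVb hUη hVη hUV hεg hδg
  set yU := RofUk L m n φ η U dU with hyUdef
  set yV := RofUk L m n φ η V dV with hyVdef
  have hyU : ‖yU‖ ≤ K * N₁ := (norm_projR_le _ _ _).trans hDsU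
  have hyV : ‖yV‖ ≤ K * N₁ := (norm_projR_le _ _ _).trans hDsV
  have hyUV : ‖yU - yV‖ ≤ ((CR * K + sD) * δ) * N₁ := by
    have e : yU - yV = (RofUk L m n φ η U dU - RofUk L m n φ η V dU) + RofUk L m n φ η V (dU - dV) := by rw [map_sub]; abel
    rw [e]
    refine (norm_add_le _ _).trans ?_
    have t1 := hR2 dU
    have t2 : ‖RofUk L m n φ η V (dU - dV)‖ ≤ (sD * δ) * ‖w‖ := (norm_projR_le _ _ _).trans hDsUV
    have t3 : CR * δ * ‖dU‖ ≤ CR * δ * (K * N₁) := mul_le_mul_of_nonneg_left hDsU (mul_nonneg hCR.le hδ0)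
    have t4 : sD * δ * ‖w‖ ≤ sD * δ * N₁ := mul_le_mul_of_nonneg_left hN₁w (by positivity)
    have e2 : ((CR * K + sD) * δ) * N₁ = CR * δ * (K * N₁) + sD * δ * N₁ := by ring
    rw [e2]; linarith only [t1, t2, t3, t4]
  /- §H the decomposition `λ_U − λ_V = (G′_U − G′_V)y_U + G′_V(y_U − y_V)` -/
  set F := GpOfUk L m n φ η U a' hposU yU - GpOfUk L m n φ η V a' hposV yU with hF
  set S := GpOfUk L m n φ η V a' hposV (yU - yV) with hS
  have hμ : GpOfUk L m n φ η U a' hposU yU - GpOfUk L m n φ η V a' hposV yV = F + S := by rw [hF, hS, map_sub]; abel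
  obtain ⟨B, hBdef⟩ : ∃ x : ℝ, x = (Θb * K * γ'⁻¹ * γ'⁻¹ + γ'⁻¹ * (CR * K + sD)) * δ * N₁ := ⟨_, rfl⟩
  have hFS : N F + N S ≤ B := by
    have hNF : N F ≤ (Θb * K * γ'⁻¹ * γ'⁻¹) * δ * N₁ := by
      calc N F ≤ (Θb * δ) / γ' * N (GpOfUk L m n φ η U a' hposU yU) := hGsub yU
        _ ≤ (Θb * δ) / γ' * (γ'⁻¹ * (K * N₁)) :=
            mul_le_mul_of_nonneg_left ((hGU yU).trans (mul_le_mul_of_nonneg_left hyU hγi)) (div_nonneg hΘδ hγ'.le)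
        _ = (Θb * K * γ'⁻¹ * γ'⁻¹) * δ * N₁ := by rw [div_eq_mul_inv]; ring
    have hNS : N S ≤ (γ'⁻¹ * (CR * K + sD)) * δ * N₁ := by
      calc N S ≤ γ'⁻¹ * ‖yU - yV‖ := hGV _
        _ ≤ γ'⁻¹ * (((CR * K + sD) * δ) * N₁) := mul_le_mul_of_nonneg_left hyUV hγi
        _ = (γ'⁻¹ * (CR * K + sD)) * δ * N₁ := by ring
    have e3 : B = (Θb * K * γ'⁻¹ * γ'⁻¹) * δ * N₁ + (γ'⁻¹ * (CR * K + sD)) * δ * N₁ := by rw [hBdef]; ring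
    rw [e3]; linarith only [hNF, hNS]
  have hnorm : ‖F + S‖ ≤ B := ((norm_add_le _ _).trans (add_le_add (hNn F) (hNn S))).trans hFS
  have hDUμ : ‖covDerivL2K ℂ c₀ ((η : ℂ))⁻¹ (adTransportW φ U) (F + S)‖ ≤ (1 + sD) * B := by
    have h0 : ‖covDerivL2K ℂ c₀ ((η : ℂ))⁻¹ (adTransportW φ (fun _ : Bond d (towerP L m (n + 1)) => (1 : 𝔸ˣ))) (F + S)‖ ≤ B := by
      rw [map_add]; exact ((norm_add_le _ _).trans (add_le_add (hND F) (hND S))).trans hFS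
    have h1 := norm_le_insert' (covDerivL2K ℂ c₀ ((η : ℂ))⁻¹ (adTransportW φ U) (F + S))
      (covDerivL2K ℂ c₀ ((η : ℂ))⁻¹ (adTransportW φ (fun _ : Bond d (towerP L m (n + 1)) => (1 : 𝔸ˣ))) (F + S))
    have hB0 : 0 ≤ B := (add_nonneg (hN0 F) (hN0 S)).trans hFS
    have h2 : (sD * α) * ‖F + S‖ ≤ sD * B := by
      calc (sD * α) * ‖F + S‖ ≤ (sD * 1) * B := mul_le_mul (mul_le_mul_of_nonneg_left hα1 hsD0) hnorm (norm_nonneg _) (by positivity)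
        _ = sD * B := by ring
    linarith only [h0, h1, h2, hDU1 (F + S)]
  have hlamV : ‖GpOfUk L m n φ η V a' hposV yV‖ ≤ γ'⁻¹ * (K * N₁) :=
    (hNn _).trans ((hGV yV).trans (mul_le_mul_of_nonneg_left hyV hγi))
  have hCB : (1 + sD) * B + sD * δ * (γ'⁻¹ * (K * N₁)) ≤ C * δ * N₁ := by
    have e4 : C * δ * N₁ = ((1 + sD) * B + sD * δ * (γ'⁻¹ * (K * N₁))) + δ * N₁ := by rw [hBdef, hCdef]; ring
    rw [e4]; linarith only [mul_nonneg hδ0 hN₁0]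
  have hB' : B ≤ C * δ * N₁ := by
    have h3 : B ≤ (1 + sD) * B := le_mul_of_one_le_left ((add_nonneg (hN0 F) (hN0 S)).trans hFS) (by linarith only [hsD0])
    linarith only [h3, hCB, (by positivity : 0 ≤ sD * δ * (γ'⁻¹ * (K * N₁)))]
  refine ⟨?_, ?_⟩
  · rw [hμ]; exact hnorm.trans hB'
  · have e : covDerivL2K ℂ c₀ ((η : ℂ))⁻¹ (adTransportW φ U) (GpOfUk L m n φ η U a' hposU yU) -
          covDerivL2K ℂ c₀ ((η : ℂ))⁻¹ (adTransportW φ V) (GpOfUk L m n φ η V a' hposV yV) =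
        covDerivL2K ℂ c₀ ((η : ℂ))⁻¹ (adTransportW φ U) (F + S) +
          (covDerivL2K ℂ c₀ ((η : ℂ))⁻¹ (adTransportW φ U) (GpOfUk L m n φ η V a' hposV yV) -
            covDerivL2K ℂ c₀ ((η : ℂ))⁻¹ (adTransportW φ V) (GpOfUk L m n φ η V a' hposV yV)) := by
      rw [← hμ, map_sub]; abel
    rw [e]
    refine (norm_add_le _ _).trans ?_
    have t := (hDUV (GpOfUk L m n φ η V a' hposV yV)).trans (mul_le_mul_of_nonneg_left hlamV (by positivity))
    linarith only [hDUμ, t, hCB]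

end Literature.MathematicalPhysics.QuantumFieldTheory.Balaban1983to89.B9Eq325GaugeModeLetterTwoBackgrounds

end
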